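import Literature.AlgebraicGeometry.Resolution.TameDescentTrace
import Literature.AlgebraicGeometry.Resolution.ResidueRoots
import Literature.AlgebraicGeometry.Resolution.GeneralizedStabilityFiniteRankLemmas
import Literature.AlgebraicGeometry.Resolution.HenselizationDirectedUnion
import Mathlib.RingTheory.Polynomial.Cyclotomic.Roots
import HarnessLib

/-!
# Tame root layers and their union (towards Temkin 2013, Thm. 3.2.3, Step 1: the passage to `L^{mr}`)

Topic: `Literature/AlgebraicGeometry/Resolution` (valued function fields). M. Temkin,
*Inseparable local uniformization*, J. Algebra 373 (2013) = arXiv:0804.1554, proof of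
Thm. 3.2.3, Step 1: "By §2.4, `L^{mr}K = \overline{L^{mr}(x)}` for a finite moderately ramified
extension and an element `x` …" — the construction passes to the maximal tame (= moderately
ramified) extension `L^{mr}` of the constant field and descends afterwards ([Duc]; algebraically:
Kuhlmann–Vlahu 2014, Thm. 14.5, `TameDescent.lean`). This file PROVES, inside an algebraically
closed valued field `(Ω, V)`, the existence of a sufficiently large TAME extension of a perfect
henselian subfield `C` of rank one, assembled from ROOT LAYERS `C(roots of P)`, `P ∈ C[X]`,
whose Galois group has TRIVIAL RAMIFICATION GROUP (`ramificationGroupIn V · = ⊥`,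
`KrullRamificationGroups.lean`; by Kuhlmann–Vlahu Thm. 13.2 this characterizes tame Galois
extensions of henselian fields — only the consequences proved in `TameValuationIndependence.lean`
are used):

* such layers are directed (`ramificationGroupIn_adjoin_rootSet_mul_eq_bot`: restriction to a
  sub-layer, `exists_restrict_algEquiv_of_rootSet_subset`);
* **Kummer layers** (`exists_tame_layer_pow_eq`): adjoining the `m`-th roots of unity and all
  `m`-th roots of all conjugates of `b`, `p ∤ m`, keeps the ramification group trivial — an
  automorphism moving an `m`-th root multiplies it by a root of unity `ω ≠ 1`, and
  `|ω − 1| = 1` (`valuation_sub_one_eq_one_of_pow_eq_one`);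
* **residue layers** (`exists_tame_layer_residue`): adjoining the roots of a monic lift of a
  separable polynomial over the residue field keeps it trivial — distinct roots have distinct
  residues;
* `exists_tame_extension` — **the union `T`**: `C ≤ T` algebraic, henselian, perfect, of rank one,
  with DIVISIBLE value group and ALGEBRAICALLY CLOSED residue field — i.e. without proper tame
  extensions, the hypotheses of `henselianRational_of_perfect_of_forall_isAlgebraic_mem`
  (`HenselianRationalityPerfectSplit.lean`) — every finite subset of which lies in one tame
  root layer.

All statements are [folklore] ramification theory in this special form; no definitions, no
named facts.

## Sources

* M. Temkin, arXiv:0804.1554v3, proof of Thm. 3.2.3, Step 1 (p. 24 of the held text); §2.4.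
  [Temkin2013]
* F.-V. Kuhlmann, I. Vlahu, Math. Z. 276 (2014) = arXiv:1304.0200, §13 (Thm. 13.2), §14.
  [KuhlmannVlahu2014]
-/

noncomputable section

open Polynomial Finset IsLocalRing IntermediateField Module

namespace Literature.AlgebraicGeometry.Resolution

universe u

variable {Ω : Type u} [Field Ω] [IsAlgClosed Ω] (V : ValuationSubring Ω)

/-! ### Roots of unity of order prime to the residue characteristic -/

omit [IsAlgClosed Ω] in
/-- **`|ω − 1| = 1` for a root of unity `ω ≠ 1` of order prime to the residue characteristic**
(`v(m) = 0`, `ω^m = 1`): otherwise `ω ≡ 1`, so `1 + ω + ⋯ + ω^{m−1} ≡ m` is a unit and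
`0 = |ω^m − 1| = |ω − 1|`. [folklore] -/
theorem valuation_sub_one_eq_one_of_pow_eq_one {ω : Ω} {m : ℕ} (hm : V.valuation (m : Ω) = 1)
    (hω : ω ^ m = 1) (hω1 : ω ≠ 1) : V.valuation (ω - 1) = 1 := by
  have hm0 : m ≠ 0 := by
    rintro rfl
    rw [Nat.cast_zero, map_zero] at hm
    exact zero_ne_one hm
  -- `|ω| = 1`
  have hvω : V.valuation ω = 1 := by
    have h := congrArg V.valuation hω
    rw [map_pow, map_one] at h
    exact (pow_eq_one_iff.mp h).resolve_right hm0
  have hle : V.valuation (ω - 1) ≤ 1 := by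
    calc V.valuation (ω - 1) ≤ max (V.valuation ω) (V.valuation 1) := Valuation.map_sub _ _ _
      _ = 1 := by rw [hvω, map_one, max_self]
  refine le_antisymm hle (not_lt.mp fun hlt => hω1 ?_)
  -- the geometric sum `s = ∑_{i<m} ω^i` has `|s - m| < 1`, hence `|s| = 1`
  set s : Ω := ∑ i ∈ Finset.range m, ω ^ i with hs
  have hpow : ∀ i : ℕ, V.valuation (ω ^ i - 1) < 1 := by
    intro i
    induction i with
    | zero => rw [pow_zero, sub_self, map_zero]; exact zero_lt_one
    | succ n ih =>
      have hid : ω ^ (n + 1) - 1 = ω * (ω ^ n - 1) + (ω - 1) := by ring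
      rw [hid]
      refine Valuation.map_add_lt _ ?_ hlt
      rw [map_mul, hvω, one_mul]; exact ih
  have hsm : V.valuation (s - m) < 1 := by
    have hid : s - m = ∑ i ∈ Finset.range m, (ω ^ i - 1) := by
      rw [Finset.sum_sub_distrib, Finset.sum_const, Finset.card_range, nsmul_eq_mul, mul_one]
    rw [hid]
    exact Valuation.map_sum_lt _ one_ne_zero fun i _ => hpow i
  have hvs : V.valuation s = 1 := by
    have hid : s = (s - m) + m := by ring
    rw [hid, Valuation.map_add_eq_of_lt_right _ (by rw [hm]; exact hsm), hm]
  -- `ω^m - 1 = (ω - 1) s`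
  have hgeom : ω ^ m - 1 = (ω - 1) * s := by
    rw [hs, mul_comm, geom_sum_mul]
  have h0 : V.valuation ((ω - 1) * s) = 0 := by rw [← hgeom, hω, sub_self, map_zero]
  rw [map_mul, hvs, mul_one, map_eq_zero, sub_eq_zero] at h0
  exact h0

/-! ### Restriction to a sub-layer; automorphisms fixing the roots -/

section Restrict

variable {C : Subfield Ω}

omit [IsAlgClosed Ω] in
/-- A `C`-automorphism maps roots of `P ∈ C[X]` to roots of `P`. [folklore] -/
theorem coe_algEquiv_apply_mem_rootSet_of_subset (P : Polynomial C) (M' : IntermediateField C Ω)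
    (σ : M' ≃ₐ[C] M') {z : M'} (hz : (z : Ω) ∈ P.rootSet Ω) : ((σ z : M') : Ω) ∈ P.rootSet Ω := by
  rw [Polynomial.mem_rootSet] at hz ⊢
  refine ⟨hz.1, ?_⟩
  have h1 : aeval z P = 0 := by
    apply (algebraMap M' Ω).injective
    rw [← Polynomial.aeval_algebraMap_apply, map_zero]
    exact hz.2
  have h2 : aeval (σ z) P = 0 := by
    change aeval ((σ : M' →ₐ[C] M') z) P = 0
    rw [Polynomial.aeval_algHom_apply, h1, map_zero]
  have h3 := congrArg (algebraMap M' Ω) h2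
  rwa [← Polynomial.aeval_algebraMap_apply, map_zero] at h3

omit [IsAlgClosed Ω] in
/-- A `C`-automorphism of `M' ⊇ roots of P` maps `C(roots of P)` into itself. [folklore] -/
theorem coe_algEquiv_apply_mem_adjoin_rootSet_of_subset (P : Polynomial C)
    (M' : IntermediateField C Ω) (hPM : P.rootSet Ω ⊆ M') (σ : M' ≃ₐ[C] M') {z : M'}
    (hz : (z : Ω) ∈ IntermediateField.adjoin C (P.rootSet Ω)) :
    ((σ z : M') : Ω) ∈ IntermediateField.adjoin C (P.rootSet Ω) := by
  have key : ∀ w ∈ Subfield.closure ((C : Set Ω) ∪ P.rootSet Ω),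
      ∃ hw : w ∈ M', ((σ ⟨w, hw⟩ : M') : Ω) ∈ IntermediateField.adjoin C (P.rootSet Ω) := by
    intro w hw
    refine Subfield.closure_induction (p := fun w _ =>
      ∃ hw : w ∈ M', ((σ ⟨w, hw⟩ : M') : Ω) ∈ IntermediateField.adjoin C (P.rootSet Ω))
      ?_ ?_ ?_ ?_ ?_ ?_ hw
    · rintro x (hxC | hxr)
      · refine ⟨M'.algebraMap_mem ⟨x, hxC⟩, ?_⟩
        have : σ ⟨x, M'.algebraMap_mem ⟨x, hxC⟩⟩ = ⟨x, M'.algebraMap_mem ⟨x, hxC⟩⟩ :=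
          σ.commutes (⟨x, hxC⟩ : C)
        rw [this]
        exact (IntermediateField.adjoin C (P.rootSet Ω)).algebraMap_mem ⟨x, hxC⟩
      · exact ⟨hPM hxr, IntermediateField.subset_adjoin C _
          (coe_algEquiv_apply_mem_rootSet_of_subset P M' σ hxr)⟩
    · exact ⟨M'.one_mem, by
        rw [show (⟨1, M'.one_mem⟩ : M') = 1 from rfl, map_one]
        exact (IntermediateField.adjoin C (P.rootSet Ω)).one_mem⟩
    · rintro x y _ _ ⟨hx, hx'⟩ ⟨hy, hy'⟩
      refine ⟨M'.add_mem hx hy, ?_⟩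
      have : (⟨x + y, M'.add_mem hx hy⟩ : M') = ⟨x, hx⟩ + ⟨y, hy⟩ := rfl
      rw [this, map_add]
      exact (IntermediateField.adjoin C (P.rootSet Ω)).add_mem hx' hy'
    · rintro x _ ⟨hx, hx'⟩
      refine ⟨M'.neg_mem hx, ?_⟩
      have : (⟨-x, M'.neg_mem hx⟩ : M') = -⟨x, hx⟩ := rfl
      rw [this, map_neg]
      exact (IntermediateField.adjoin C (P.rootSet Ω)).neg_mem hx'
    · rintro x _ ⟨hx, hx'⟩
      refine ⟨M'.inv_mem hx, ?_⟩
      have : (⟨x⁻¹, M'.inv_mem hx⟩ : M') = ⟨x, hx⟩⁻¹ := rfl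
      rw [this, map_inv₀]
      exact (IntermediateField.adjoin C (P.rootSet Ω)).inv_mem hx'
    · rintro x y _ _ ⟨hx, hx'⟩ ⟨hy, hy'⟩
      refine ⟨M'.mul_mem hx hy, ?_⟩
      have : (⟨x * y, M'.mul_mem hx hy⟩ : M') = ⟨x, hx⟩ * ⟨y, hy⟩ := rfl
      rw [this, map_mul]
      exact (IntermediateField.adjoin C (P.rootSet Ω)).mul_mem hx' hy'
  have hzc : (z : Ω) ∈ Subfield.closure ((C : Set Ω) ∪ P.rootSet Ω) := by
    rwa [← mem_adjoin_subfield_iff]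
  obtain ⟨hw, h⟩ := key (z : Ω) hzc
  exact h

omit [IsAlgClosed Ω] in
/-- **Restriction to a sub-layer**: a `C`-automorphism of `M' ⊇ roots of P` restricts to a
`C`-automorphism of `C(roots of P)`. [folklore] -/
theorem exists_restrict_algEquiv_of_rootSet_subset (P : Polynomial C) (M' : IntermediateField C Ω)
    (hPM : P.rootSet Ω ⊆ M') (σ : M' ≃ₐ[C] M') :
    ∃ τ : (IntermediateField.adjoin C (P.rootSet Ω)) ≃ₐ[C] (IntermediateField.adjoin C (P.rootSet Ω)),
      ∀ z : IntermediateField.adjoin C (P.rootSet Ω),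
        ((τ z : IntermediateField.adjoin C (P.rootSet Ω)) : Ω) =
          ((σ ⟨z, (IntermediateField.adjoin_le_iff.mpr hPM) z.2⟩ : M') : Ω) := by
  haveI : FiniteDimensional C (IntermediateField.adjoin C (P.rootSet Ω)) :=
    finiteDimensional_adjoin_rootSet_subfield P
  have hLM : ∀ z : IntermediateField.adjoin C (P.rootSet Ω), (z : Ω) ∈ M' := fun z =>
    (IntermediateField.adjoin_le_iff.mpr hPM) z.2
  have hst : ∀ z : IntermediateField.adjoin C (P.rootSet Ω),
      ((σ ⟨z, hLM z⟩ : M') : Ω) ∈ IntermediateField.adjoin C (P.rootSet Ω) := fun z =>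
    coe_algEquiv_apply_mem_adjoin_rootSet_of_subset P M' hPM σ z.2
  let ψ : (IntermediateField.adjoin C (P.rootSet Ω)) →ₐ[C] (IntermediateField.adjoin C (P.rootSet Ω)) :=
    { toFun := fun z => ⟨_, hst z⟩
      map_one' := by
        apply Subtype.ext
        change ((σ ⟨((1 : IntermediateField.adjoin C (P.rootSet Ω)) : Ω), hLM 1⟩ : M') : Ω) = 1
        rw [show (⟨((1 : IntermediateField.adjoin C (P.rootSet Ω)) : Ω), hLM 1⟩ : M') = 1 from rfl, map_one]
        rfl
      map_mul' := fun x y => by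
        apply Subtype.ext
        change ((σ ⟨((x * y : IntermediateField.adjoin C (P.rootSet Ω)) : Ω), hLM (x * y)⟩ : M') : Ω) =
          ((σ ⟨(x : Ω), hLM x⟩ : M') : Ω) * ((σ ⟨(y : Ω), hLM y⟩ : M') : Ω)
        rw [show (⟨((x * y : IntermediateField.adjoin C (P.rootSet Ω)) : Ω), hLM (x * y)⟩ : M') =
          ⟨(x : Ω), hLM x⟩ * ⟨(y : Ω), hLM y⟩ from rfl, map_mul]
        rfl
      map_zero' := by
        apply Subtype.ext
        change ((σ ⟨((0 : IntermediateField.adjoin C (P.rootSet Ω)) : Ω), hLM 0⟩ : M') : Ω) = 0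
        rw [show (⟨((0 : IntermediateField.adjoin C (P.rootSet Ω)) : Ω), hLM 0⟩ : M') = 0 from rfl, map_zero]
        rfl
      map_add' := fun x y => by
        apply Subtype.ext
        change ((σ ⟨((x + y : IntermediateField.adjoin C (P.rootSet Ω)) : Ω), hLM (x + y)⟩ : M') : Ω) =
          ((σ ⟨(x : Ω), hLM x⟩ : M') : Ω) + ((σ ⟨(y : Ω), hLM y⟩ : M') : Ω)
        rw [show (⟨((x + y : IntermediateField.adjoin C (P.rootSet Ω)) : Ω), hLM (x + y)⟩ : M') =
          ⟨(x : Ω), hLM x⟩ + ⟨(y : Ω), hLM y⟩ from rfl, map_add]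
        rfl
      commutes' := fun c => by
        apply Subtype.ext
        change ((σ ⟨((algebraMap C (IntermediateField.adjoin C (P.rootSet Ω)) c :
          IntermediateField.adjoin C (P.rootSet Ω)) : Ω), hLM _⟩ : M') : Ω) =
          ((algebraMap C (IntermediateField.adjoin C (P.rootSet Ω)) c : IntermediateField.adjoin C (P.rootSet Ω)) : Ω)
        have h1 : (⟨((algebraMap C (IntermediateField.adjoin C (P.rootSet Ω)) c :
            IntermediateField.adjoin C (P.rootSet Ω)) : Ω), hLM _⟩ : M') = algebraMap C M' c := rfl
        rw [h1, σ.commutes]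
        rfl }
  have hinj : Function.Injective ψ := ψ.toRingHom.injective
  have hbij : Function.Bijective ψ :=
    ⟨hinj, (LinearMap.injective_iff_surjective (f := ψ.toLinearMap)).mp hinj⟩
  exact ⟨AlgEquiv.ofBijective ψ hbij, fun z => by rw [AlgEquiv.ofBijective_apply]; rfl⟩

omit [IsAlgClosed Ω] in
/-- **An automorphism of a root layer fixing every root is the identity.** [folklore] -/
theorem algEquiv_eq_one_of_forall_mem_rootSet (R : Polynomial C)
    {σ : (IntermediateField.adjoin C (R.rootSet Ω)) ≃ₐ[C] (IntermediateField.adjoin C (R.rootSet Ω))}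
    (h : ∀ z : IntermediateField.adjoin C (R.rootSet Ω), (z : Ω) ∈ R.rootSet Ω → σ z = z) : σ = 1 := by
  have key : ∀ w ∈ Subfield.closure ((C : Set Ω) ∪ R.rootSet Ω),
      ∃ hw : w ∈ IntermediateField.adjoin C (R.rootSet Ω), σ ⟨w, hw⟩ = ⟨w, hw⟩ := by
    intro w hw
    refine Subfield.closure_induction (p := fun w _ =>
      ∃ hw : w ∈ IntermediateField.adjoin C (R.rootSet Ω), σ ⟨w, hw⟩ = ⟨w, hw⟩) ?_ ?_ ?_ ?_ ?_ ?_ hw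
    · rintro x (hxC | hxr)
      · exact ⟨(IntermediateField.adjoin C (R.rootSet Ω)).algebraMap_mem ⟨x, hxC⟩, σ.commutes (⟨x, hxC⟩ : C)⟩
      · exact ⟨IntermediateField.subset_adjoin C _ hxr, h _ hxr⟩
    · exact ⟨(IntermediateField.adjoin C (R.rootSet Ω)).one_mem, by
        rw [show (⟨1, (IntermediateField.adjoin C (R.rootSet Ω)).one_mem⟩ :
          IntermediateField.adjoin C (R.rootSet Ω)) = 1 from rfl, map_one]⟩
    · rintro x y _ _ ⟨hx, hx'⟩ ⟨hy, hy'⟩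
      refine ⟨add_mem hx hy, ?_⟩
      have : (⟨x + y, add_mem hx hy⟩ : IntermediateField.adjoin C (R.rootSet Ω)) = ⟨x, hx⟩ + ⟨y, hy⟩ := rfl
      rw [this, map_add, hx', hy']
    · rintro x _ ⟨hx, hx'⟩
      refine ⟨neg_mem hx, ?_⟩
      have : (⟨-x, neg_mem hx⟩ : IntermediateField.adjoin C (R.rootSet Ω)) = -⟨x, hx⟩ := rfl
      rw [this, map_neg, hx']
    · rintro x _ ⟨hx, hx'⟩
      refine ⟨inv_mem hx, ?_⟩
      have : (⟨x⁻¹, inv_mem hx⟩ : IntermediateField.adjoin C (R.rootSet Ω)) = ⟨x, hx⟩⁻¹ := rfl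
      rw [this, map_inv₀, hx']
    · rintro x y _ _ ⟨hx, hx'⟩ ⟨hy, hy'⟩
      refine ⟨mul_mem hx hy, ?_⟩
      have : (⟨x * y, mul_mem hx hy⟩ : IntermediateField.adjoin C (R.rootSet Ω)) = ⟨x, hx⟩ * ⟨y, hy⟩ := rfl
      rw [this, map_mul, hx', hy']
  apply AlgEquiv.ext
  intro w
  have hwc : (w : Ω) ∈ Subfield.closure ((C : Set Ω) ∪ R.rootSet Ω) := by
    rw [← mem_adjoin_subfield_iff]; exact w.2
  obtain ⟨hw, heq⟩ := key (w : Ω) hwc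
  rw [AlgEquiv.one_apply]
  exact heq

/-! ### Tame root layers are directed -/

omit [IsAlgClosed Ω] in
/-- Roots of `P` are roots of `P * Q` (`Q ≠ 0`). [folklore] -/
theorem rootSet_subset_rootSet_mul_left {P Q : Polynomial C} (hP : P ≠ 0) (hQ : Q ≠ 0) :
    P.rootSet Ω ⊆ (P * Q).rootSet Ω := by
  intro a ha
  rw [Polynomial.mem_rootSet] at ha ⊢
  exact ⟨mul_ne_zero hP hQ, by rw [map_mul, ha.2, zero_mul]⟩

omit [IsAlgClosed Ω] in
/-- Roots of `Q` are roots of `P * Q` (`P ≠ 0`). [folklore] -/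
theorem rootSet_subset_rootSet_mul_right {P Q : Polynomial C} (hP : P ≠ 0) (hQ : Q ≠ 0) :
    Q.rootSet Ω ⊆ (P * Q).rootSet Ω := by
  rw [mul_comm]; exact rootSet_subset_rootSet_mul_left hQ hP

omit [IsAlgClosed Ω] in
/-- Roots of `P * Q` are roots of `P` or of `Q`. [folklore] -/
theorem mem_rootSet_or_of_mem_rootSet_mul {P Q : Polynomial C} {a : Ω} (ha : a ∈ (P * Q).rootSet Ω) :
    a ∈ P.rootSet Ω ∨ a ∈ Q.rootSet Ω := by
  rw [Polynomial.mem_rootSet] at ha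
  obtain ⟨hPQ, h0⟩ := ha
  rw [map_mul, mul_eq_zero] at h0
  rcases h0 with h | h
  · exact Or.inl (Polynomial.mem_rootSet.mpr ⟨left_ne_zero_of_mul hPQ, h⟩)
  · exact Or.inr (Polynomial.mem_rootSet.mpr ⟨right_ne_zero_of_mul hPQ, h⟩)

omit [IsAlgClosed Ω] in
/-- `C(roots P) ≤ C(roots (P Q))`. [folklore] -/
theorem adjoin_rootSet_le_mul_left {P Q : Polynomial C} (hP : P ≠ 0) (hQ : Q ≠ 0) :
    IntermediateField.adjoin C (P.rootSet Ω) ≤ IntermediateField.adjoin C ((P * Q).rootSet Ω) :=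
  IntermediateField.adjoin.mono C _ _ (rootSet_subset_rootSet_mul_left hP hQ)

omit [IsAlgClosed Ω] in
/-- `C(roots Q) ≤ C(roots (P Q))`. [folklore] -/
theorem adjoin_rootSet_le_mul_right {P Q : Polynomial C} (hP : P ≠ 0) (hQ : Q ≠ 0) :
    IntermediateField.adjoin C (Q.rootSet Ω) ≤ IntermediateField.adjoin C ((P * Q).rootSet Ω) :=
  IntermediateField.adjoin.mono C _ _ (rootSet_subset_rootSet_mul_right hP hQ)

omit [IsAlgClosed Ω] in
/-- **An element of the ramification group fixes every tame sub-layer pointwise**: if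
`roots of P ⊆ M'`, `G^r(C(roots P)|C) = 1`, and `σ ∈ G^r(M'|C)`, then `σ z = z` for
`z ∈ C(roots P)`. [folklore] -/
theorem algEquiv_apply_eq_of_mem_ramificationGroupIn (P : Polynomial C) (M' : IntermediateField C Ω)
    [FiniteDimensional C M'] (hPM : P.rootSet Ω ⊆ M')
    (hP : ramificationGroupIn V (IntermediateField.adjoin C (P.rootSet Ω)) = ⊥)
    {σ : M' ≃ₐ[C] M'} (hσ : σ ∈ ramificationGroupIn V M') {z : M'}
    (hz : (z : Ω) ∈ IntermediateField.adjoin C (P.rootSet Ω)) : σ z = z := by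
  obtain ⟨τ, hτ⟩ := exists_restrict_algEquiv_of_rootSet_subset P M' hPM σ
  have hτmem : τ ∈ ramificationGroupIn V (IntermediateField.adjoin C (P.rootSet Ω)) := by
    rw [mem_ramificationGroupIn_iff]
    intro w hw
    have hw0 : (⟨(w : Ω), (IntermediateField.adjoin_le_iff.mpr hPM) w.2⟩ : M') ≠ 0 := fun h0 =>
      hw (Subtype.ext (congrArg Subtype.val h0 :))
    have h := (mem_ramificationGroupIn_iff V M' σ).mp hσ _ hw0
    rw [hτ w]
    exact h
  rw [hP, Subgroup.mem_bot] at hτmem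
  have h1 := hτ ⟨z, hz⟩
  rw [hτmem, AlgEquiv.one_apply] at h1
  apply Subtype.ext
  have hz' : (⟨((⟨(z : Ω), hz⟩ : IntermediateField.adjoin C (P.rootSet Ω)) : Ω),
      (IntermediateField.adjoin_le_iff.mpr hPM) hz⟩ : M') = z := Subtype.ext rfl
  rw [hz'] at h1
  exact h1.symm

omit [IsAlgClosed Ω] in
/-- **Tame root layers are directed**: `G^r = 1` for `C(roots P)` and `C(roots Q)` implies
`G^r = 1` for `C(roots (P Q))`. [folklore] -/
theorem ramificationGroupIn_adjoin_rootSet_mul_eq_bot {P Q : Polynomial C} (hP0 : P ≠ 0) (hQ0 : Q ≠ 0)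
    (hP : ramificationGroupIn V (IntermediateField.adjoin C (P.rootSet Ω)) = ⊥)
    (hQ : ramificationGroupIn V (IntermediateField.adjoin C (Q.rootSet Ω)) = ⊥) :
    ramificationGroupIn V (IntermediateField.adjoin C ((P * Q).rootSet Ω)) = ⊥ := by
  haveI : FiniteDimensional C (IntermediateField.adjoin C ((P * Q).rootSet Ω)) :=
    finiteDimensional_adjoin_rootSet_subfield (P * Q)
  refine (Subgroup.eq_bot_iff_forall _).mpr fun σ hσ => ?_
  refine algEquiv_eq_one_of_forall_mem_rootSet (P * Q) fun z hz => ?_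
  rcases mem_rootSet_or_of_mem_rootSet_mul hz with hzP | hzQ
  · exact algEquiv_apply_eq_of_mem_ramificationGroupIn V P _
      ((rootSet_subset_rootSet_mul_left hP0 hQ0).trans (IntermediateField.subset_adjoin C _)) hP hσ
      (IntermediateField.subset_adjoin C _ hzP)
  · exact algEquiv_apply_eq_of_mem_ramificationGroupIn V Q _
      ((rootSet_subset_rootSet_mul_right hP0 hQ0).trans (IntermediateField.subset_adjoin C _)) hQ hσ
      (IntermediateField.subset_adjoin C _ hzQ)

omit [IsAlgClosed Ω] in
/-- The trivial layer `C = C(roots 1)` is tame. [folklore] -/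
theorem ramificationGroupIn_adjoin_rootSet_one_eq_bot :
    ramificationGroupIn V (IntermediateField.adjoin C ((1 : Polynomial C).rootSet Ω)) = ⊥ := by
  refine (Subgroup.eq_bot_iff_forall _).mpr fun σ _ => ?_
  refine algEquiv_eq_one_of_forall_mem_rootSet 1 fun z hz => ?_
  have hz' : (z : Ω) ∉ (1 : Polynomial C).rootSet Ω := by simp [Polynomial.rootSet_one]
  exact absurd hz hz'

end Restrict


/-! ### Kummer layers -/

section Kummer

variable {C : Subfield Ω}

/-- **Kummer layers are tame**: for a tame root layer `L = C(roots P)` (`G^r = 1`), `b ∈ L^×`,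
and `m` prime to the residue characteristic (`v(m) = 0`), the root layer of
`R = P · (X^m − 1) · q(X^m)`, `q` the minimal polynomial of `b` over `C` — i.e. `L` with the
`m`-th roots of unity and all `m`-th roots of all conjugates of `b` adjoined — is again tame and
contains an `m`-th root of `b`. An element `σ` of its ramification group fixes `L` pointwise
(tameness of `L`), hence each conjugate of `b`; so it multiplies `m`-th roots `a` (of unity or of
conjugates of `b`) by roots of unity `ω`, and `σ a ≠ a` would give `|σ a − a| = |a| |ω − 1| = |a|`
(`valuation_sub_one_eq_one_of_pow_eq_one`), contradicting `σ ∈ G^r`. [folklore] -/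
theorem exists_tame_layer_pow_eq {P : Polynomial C} (hP0 : P ≠ 0)
    (hP : ramificationGroupIn V (IntermediateField.adjoin C (P.rootSet Ω)) = ⊥)
    {b : Ω} (hb : b ∈ IntermediateField.adjoin C (P.rootSet Ω)) (hb0 : b ≠ 0) {m : ℕ} (hm0 : m ≠ 0)
    (hm : V.valuation (m : Ω) = 1) :
    ∃ R : Polynomial C, R ≠ 0 ∧ ramificationGroupIn V (IntermediateField.adjoin C (R.rootSet Ω)) = ⊥ ∧
      IntermediateField.adjoin C (P.rootSet Ω) ≤ IntermediateField.adjoin C (R.rootSet Ω) ∧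
      ∃ a ∈ IntermediateField.adjoin C (R.rootSet Ω), a ^ m = b := by
  classical
  haveI : FiniteDimensional C (IntermediateField.adjoin C (P.rootSet Ω)) :=
    finiteDimensional_adjoin_rootSet_subfield P
  set bL : IntermediateField.adjoin C (P.rootSet Ω) := ⟨b, hb⟩ with hbLdef
  have hbint : IsIntegral C b := by
    have h := Algebra.IsIntegral.isIntegral (R := C) bL
    exact IntermediateField.isIntegral_iff.mp h
  set q : Polynomial C := minpoly C b with hqdef
  have hq0 : q ≠ 0 := minpoly.ne_zero hbint
  set Q₁ : Polynomial C := Polynomial.X ^ m - 1 with hQ₁def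
  have hQ₁0 : Q₁ ≠ 0 := (Polynomial.monic_X_pow_sub_C (1 : C) hm0).ne_zero
  set Q₂ : Polynomial C := Polynomial.expand C m q with hQ₂def
  have hQ₂0 : Q₂ ≠ 0 := by rw [hQ₂def, Ne, Polynomial.expand_eq_zero (Nat.pos_of_ne_zero hm0)]; exact hq0
  set R : Polynomial C := P * (Q₁ * Q₂) with hRdef
  have hR0 : R ≠ 0 := mul_ne_zero hP0 (mul_ne_zero hQ₁0 hQ₂0)
  haveI : FiniteDimensional C (IntermediateField.adjoin C (R.rootSet Ω)) :=
    finiteDimensional_adjoin_rootSet_subfield R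
  have hLR : IntermediateField.adjoin C (P.rootSet Ω) ≤ IntermediateField.adjoin C (R.rootSet Ω) :=
    adjoin_rootSet_le_mul_left hP0 (mul_ne_zero hQ₁0 hQ₂0)
  -- the roots of `q` (conjugates of `b`) lie in `L` and are non-zero
  have hqroots : ∀ b' ∈ q.rootSet Ω, b' ∈ IntermediateField.adjoin C (P.rootSet Ω) := by
    have hspl : ((minpoly C bL).map (algebraMap C (IntermediateField.adjoin C (P.rootSet Ω)))).Splits :=
      (normal_adjoin_rootSet_subfield P).splits bL
    rw [IntermediateField.minpoly_eq bL] at hspl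
    exact (IntermediateField.splits_iff_mem (IsAlgClosed.splits _)).mp hspl
  have hqroots0 : ∀ b' ∈ q.rootSet Ω, b' ≠ 0 := by
    intro b' hb' h0
    rw [Polynomial.mem_rootSet] at hb'
    have h1 : (minpoly C b).coeff 0 = 0 := by
      have h2 := hb'.2
      rw [h0, Polynomial.aeval_def, Polynomial.eval₂_at_zero, map_eq_zero] at h2
      exact h2
    exact minpoly.coeff_zero_ne_zero hbint hb0 h1
  -- an `m`-th root of `b`
  obtain ⟨a, ha⟩ := IsAlgClosed.exists_pow_nat_eq b (Nat.pos_of_ne_zero hm0)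
  have haR : a ∈ R.rootSet Ω := by
    refine rootSet_subset_rootSet_mul_right hP0 (mul_ne_zero hQ₁0 hQ₂0)
      (rootSet_subset_rootSet_mul_right hQ₁0 hQ₂0 ?_)
    rw [Polynomial.mem_rootSet]
    refine ⟨hQ₂0, ?_⟩
    rw [hQ₂def, Polynomial.expand_aeval, ha, hqdef]
    exact minpoly.aeval C b
  refine ⟨R, hR0, ?_, hLR, a, IntermediateField.subset_adjoin C _ haR, ha⟩
  -- tameness
  refine (Subgroup.eq_bot_iff_forall _).mpr fun σ hσ => ?_
  refine algEquiv_eq_one_of_forall_mem_rootSet R fun z hz => ?_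
  have hσ' := (mem_ramificationGroupIn_iff V _ σ).mp hσ
  -- `σ` fixes `L` pointwise
  have hfixL : ∀ w : IntermediateField.adjoin C (R.rootSet Ω),
      (w : Ω) ∈ IntermediateField.adjoin C (P.rootSet Ω) → σ w = w := fun w hw =>
    algEquiv_apply_eq_of_mem_ramificationGroupIn V P _
      ((rootSet_subset_rootSet_mul_left hP0 (mul_ne_zero hQ₁0 hQ₂0)).trans
        (IntermediateField.subset_adjoin C _)) hP hσ hw
  -- the key step: an automorphism moving `z` with `(σ z)^m = z^m ≠ 0` is impossible in `G^r`
  have key : ∀ w : IntermediateField.adjoin C (R.rootSet Ω), (w : Ω) ≠ 0 →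
      ((σ w : IntermediateField.adjoin C (R.rootSet Ω)) : Ω) ^ m = (w : Ω) ^ m → σ w = w := by
    intro w hw0 hpow
    by_contra hne
    set ω : Ω := ((σ w : IntermediateField.adjoin C (R.rootSet Ω)) : Ω) / w with hωdef
    have hωm : ω ^ m = 1 := by rw [hωdef, div_pow, hpow, div_self (pow_ne_zero m hw0)]
    have hω1 : ω ≠ 1 := by
      intro h1
      rw [hωdef, div_eq_one_iff_eq hw0] at h1
      exact hne (Subtype.ext h1)
    have hv : V.valuation (((σ w : IntermediateField.adjoin C (R.rootSet Ω)) : Ω) - w) = V.valuation (w : Ω) := by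
      have hid : ((σ w : IntermediateField.adjoin C (R.rootSet Ω)) : Ω) - w = (w : Ω) * (ω - 1) := by
        rw [hωdef]; field_simp
      rw [hid, map_mul, valuation_sub_one_eq_one_of_pow_eq_one V hm hωm hω1, mul_one]
    have hlt := hσ' w (fun h0 => hw0 (congrArg Subtype.val h0 :))
    rw [hv] at hlt
    exact lt_irrefl _ hlt
  rcases mem_rootSet_or_of_mem_rootSet_mul hz with hzP | hzQ
  · exact hfixL z (IntermediateField.subset_adjoin C _ hzP)
  rcases mem_rootSet_or_of_mem_rootSet_mul hzQ with hz₁ | hz₂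
  · -- `z` is an `m`-th root of unity, and so is `σ z`
    have hzm : ∀ w : IntermediateField.adjoin C (R.rootSet Ω), (w : Ω) ∈ Q₁.rootSet Ω → (w : Ω) ^ m = 1 := by
      intro w hw
      rw [Polynomial.mem_rootSet] at hw
      have h := hw.2
      rw [hQ₁def, map_sub, map_pow, aeval_X, map_one, sub_eq_zero] at h
      exact h
    have h1 := hzm z hz₁
    have h2 := hzm (σ z) (coe_algEquiv_apply_mem_rootSet_of_subset Q₁ _ σ hz₁)
    have hz0 : (z : Ω) ≠ 0 := fun h0 => by rw [h0, zero_pow hm0] at h1; exact zero_ne_one h1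
    exact key z hz0 (by rw [h1, h2])
  · -- `z^m` is a conjugate of `b`, fixed by `σ`
    rw [Polynomial.mem_rootSet] at hz₂
    have hzq : (z : Ω) ^ m ∈ q.rootSet Ω := by
      rw [Polynomial.mem_rootSet]
      refine ⟨hq0, ?_⟩
      have h := hz₂.2
      rwa [hQ₂def, Polynomial.expand_aeval] at h
    have hzmL : ((z ^ m : IntermediateField.adjoin C (R.rootSet Ω)) : Ω) ∈
        IntermediateField.adjoin C (P.rootSet Ω) := by
      push_cast; exact hqroots _ hzq
    have hfix := hfixL (z ^ m) hzmL
    have hz0 : (z : Ω) ≠ 0 := fun h0 => hqroots0 _ hzq (by rw [h0, zero_pow hm0])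
    refine key z hz0 ?_
    have h := congrArg (fun w : IntermediateField.adjoin C (R.rootSet Ω) => (w : Ω)) hfix
    simp only [map_pow] at h
    push_cast at h
    exact h

end Kummer

/-! ### Residue layers -/

section Residue

variable {C : Subfield Ω} (p : ℕ) [hp : Fact p.Prime] [CharP (ResidueField V) p]

/-- **Residue layers are tame**: for `C` perfect, every element of `Ωv` algebraic over the
residue field `Cv` is a residue of an element of a TAME root layer — the layer of a monic lift
`g ∈ C°[X]` of its (separable) minimal polynomial over `Cv`: the roots of `g` have pairwise
distinct residues, so an automorphism `σ` of the layer moving a root `θ` has `|σ θ − θ| = 1 ≥ |θ|`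
and cannot lie in the ramification group. [folklore] -/
theorem exists_tame_layer_residue (hperf : ∀ y ∈ C, ∃ b ∈ C, b ^ p = y) {α : ResidueField V}
    (hα : IsAlgebraic (resField V C) α) :
    ∃ R : Polynomial C, R ≠ 0 ∧ ramificationGroupIn V (IntermediateField.adjoin C (R.rootSet Ω)) = ⊥ ∧
      α ∈ resField V (IntermediateField.adjoin C (R.rootSet Ω)).toSubfield := by
  classical
  -- the residue field `k = Cv` is perfect; the minimal polynomial `φ` of `α` is separable
  haveI : PerfectField (residueSubfield C V) := perfectField_residueSubfield_of_perfect V p hperf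
  have hα' : IsAlgebraic (residueSubfield C V) α := by rw [← resField_eq_residueSubfield]; exact hα
  have hint : IsIntegral (residueSubfield C V) α := hα'.isIntegral
  set φ : Polynomial (residueSubfield C V) := minpoly (residueSubfield C V) α with hφdef
  have hφmon : φ.Monic := minpoly.monic hint
  have hφsep : φ.Separable := PerfectField.separable_of_irreducible (minpoly.irreducible hint)
  -- lift `φ` to a monic `g₀` over `O = V ∩ C`
  set O : ValuationSubring C := V.comap (algebraMap C Ω) with hOdef
  let θk : O →+* residueSubfield C V :=
    (residueHom V C).codRestrict (residueSubfield C V) (residueHom_mem V C)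
  have hθk : Function.Surjective θk := by
    rintro ⟨r, hr⟩
    obtain ⟨c, hc, hcr⟩ := (mem_residueSubfield_iff C V r).mp hr
    exact ⟨⟨c, hc⟩, Subtype.ext hcr⟩
  have hθk_comp : (algebraMap (residueSubfield C V) (ResidueField V)).comp θk = residueHom V C :=
    RingHom.ext fun _ => rfl
  obtain ⟨g₀, hg₀, hdeg, hmon₀⟩ := Polynomial.lifts_and_natDegree_eq_and_monic
    ((Polynomial.mem_lifts φ).mpr (Polynomial.map_surjective θk hθk φ)) hφmon
  -- `g` over `C`, `gV` over `V`, and their common image over `Ω`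
  set g : Polynomial C := g₀.map (algebraMap O C) with hgdef
  have hgmon : g.Monic := hmon₀.map _
  have hg0 : g ≠ 0 := hgmon.ne_zero
  let ι : O →+* V :=
    { toFun := fun c => ⟨((c : C) : Ω), c.2⟩
      map_one' := rfl
      map_mul' := fun _ _ => rfl
      map_zero' := rfl
      map_add' := fun _ _ => rfl }
  set gV : Polynomial V := g₀.map ι with hgVdef
  have hgVmon : gV.Monic := hmon₀.map ι
  have hgVΩ : gV.map (algebraMap V Ω) = g.map (algebraMap C Ω) := by
    rw [hgVdef, hgdef, Polynomial.map_map, Polynomial.map_map]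
    rfl
  have hθι : (residue V).comp ι = residueHom V C := RingHom.ext fun _ => rfl
  have hgVres : gV.map (residue V) = φ.map (algebraMap (residueSubfield C V) (ResidueField V)) := by
    rw [hgVdef, Polynomial.map_map, hθι, ← hg₀, Polynomial.map_map, hθk_comp]
  -- factor `gV` over `V`; residues of the roots are the roots of `φ`, without repetition
  obtain ⟨T, hT, hTroots⟩ := exists_multiset_prod_X_sub_C_eq V hgVmon
  obtain ⟨-, hres⟩ := map_residue_eq_prod V hT
  rw [hgVres] at hres
  have hnodup : (T.map (residue V)).Nodup := by
    rw [← hres]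
    exact Polynomial.nodup_roots hφsep.map
  -- `α` is among the residues
  have hαroot : α ∈ (φ.map (algebraMap (residueSubfield C V) (ResidueField V))).roots := by
    rw [Polynomial.mem_roots (hφmon.map _).ne_zero, Polynomial.IsRoot.def, Polynomial.eval_map,
      ← Polynomial.aeval_def, hφdef]
    exact minpoly.aeval _ α
  rw [hres] at hαroot
  obtain ⟨bα, hbαT, hbα⟩ := Multiset.mem_map.mp hαroot
  have hbαroot : ((bα : V) : Ω) ∈ g.rootSet Ω := by
    have h1 : ((bα : V) : Ω) ∈ (gV.map (algebraMap V Ω)).roots := by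
      rw [← hTroots]; exact Multiset.mem_map_of_mem _ hbαT
    rw [hgVΩ] at h1
    rw [Polynomial.mem_rootSet]
    exact ⟨hg0, by
      have h2 := (Polynomial.mem_roots (hgmon.map _).ne_zero).mp h1
      rwa [Polynomial.IsRoot.def, Polynomial.eval_map, ← Polynomial.aeval_def] at h2⟩
  refine ⟨g, hg0, ?_, ?_⟩
  · -- tameness
    haveI : FiniteDimensional C (IntermediateField.adjoin C (g.rootSet Ω)) :=
      finiteDimensional_adjoin_rootSet_subfield g
    refine (Subgroup.eq_bot_iff_forall _).mpr fun σ hσ => ?_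
    refine algEquiv_eq_one_of_forall_mem_rootSet g fun z hz => ?_
    by_contra hne
    have hσ' := (mem_ramificationGroupIn_iff V _ σ).mp hσ
    have hz0 : z ≠ 0 := by
      intro h0
      rw [h0, map_zero] at hne
      exact hne rfl
    have hσz : ((σ z : IntermediateField.adjoin C (g.rootSet Ω)) : Ω) ∈ g.rootSet Ω :=
      coe_algEquiv_apply_mem_rootSet_of_subset g _ σ hz
    -- both roots lift to elements of `T`
    have hmemT : ∀ w : Ω, w ∈ g.rootSet Ω → ∃ c ∈ T, ((c : V) : Ω) = w := by
      intro w hw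
      rw [Polynomial.mem_rootSet] at hw
      have h1 : w ∈ (g.map (algebraMap C Ω)).roots := by
        rw [Polynomial.mem_roots (hgmon.map _).ne_zero, Polynomial.IsRoot.def, Polynomial.eval_map,
          ← Polynomial.aeval_def]
        exact hw.2
      rw [← hgVΩ, ← hTroots] at h1
      exact Multiset.mem_map.mp h1
    obtain ⟨c₁, hc₁T, hc₁⟩ := hmemT _ hz
    obtain ⟨c₂, hc₂T, hc₂⟩ := hmemT _ hσz
    have hc12 : c₁ ≠ c₂ := by
      intro h12
      apply hne
      apply Subtype.ext
      rw [← hc₂, ← h12, hc₁]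
    -- distinct residues
    have hres12 : residue V c₁ ≠ residue V c₂ := fun h12 =>
      hc12 (Multiset.inj_on_of_nodup_map hnodup c₁ hc₁T c₂ hc₂T h12)
    have hv1 : V.valuation (((c₂ : V) : Ω) - c₁) = 1 := by
      have hne0 : residue V (c₂ - c₁) ≠ 0 := by
        rw [map_sub, sub_ne_zero]; exact hres12.symm
      rw [ne_eq, residue_eq_zero_iff, V.valuation_lt_one_iff] at hne0
      push_cast at hne0
      exact le_antisymm ((V.valuation_le_one_iff _).mpr (sub_mem c₂.2 c₁.2)) (not_lt.mp hne0)
    have hlt := hσ' z hz0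
    rw [← hc₁, ← hc₂] at hlt
    rw [hv1] at hlt
    exact absurd ((V.valuation_le_one_iff _).mpr c₁.2) (not_le.mpr hlt)
  · -- `α` is a residue of the layer
    have hbL : ((bα : V) : Ω) ∈ (IntermediateField.adjoin C (g.rootSet Ω)).toSubfield :=
      IntermediateField.subset_adjoin C _ hbαroot
    rw [← hbα]
    exact residue_mem_resField V bα hbL

end Residue


/-! ### The union of the tame root layers -/

section Union

variable {C : Subfield Ω}

omit [IsAlgClosed Ω] in
/-- `v(m) = 0` for `m` prime to the residue characteristic. [folklore] -/
theorem valuation_natCast_eq_one_of_not_dvd_residueChar (p : ℕ) [CharP (ResidueField V) p] {m : ℕ} (hm : ¬ p ∣ m) :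
    V.valuation (m : Ω) = 1 := by
  have hmV : ((m : V) : Ω) = (m : Ω) := by push_cast; rfl
  have hres : residue V (m : V) ≠ 0 := by
    rw [map_natCast, ne_eq, CharP.cast_eq_zero_iff (ResidueField V) p m]
    exact hm
  rw [ne_eq, residue_eq_zero_iff, V.valuation_lt_one_iff, hmV, not_lt] at hres
  exact le_antisymm ((V.valuation_le_one_iff _).mpr (hmV ▸ (m : V).2)) hres

variable (p : ℕ) [hp : Fact p.Prime] [CharP Ω p] [CharP (ResidueField V) p]

/-- **A tame algebraic extension without proper tame extensions.** Let `C ≤ Ω` be perfect,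
henselian and of rank one (`Ω` algebraically closed of characteristic `p`, residue characteristic
`p`). There is a subfield `T`, `C ≤ T ≤ Ω`, algebraic over `C`, henselian, perfect, of rank one,
with DIVISIBLE value group (every value of `T^×` is an `n`-th power of a value of `T^×`, `n ≥ 1`)
and ALGEBRAICALLY CLOSED residue field, which is the directed union of the TAME ROOT LAYERS
`C(roots of P)`, `P ∈ C[X]` non-zero with `ramificationGroupIn V (C(roots P)) = ⊥`: every
finite subset of `T` lies in one of them. (The algebraic stand-in for the maximal tame extension
`L^{mr}` of Temkin 2013, proof of Thm. 3.2.3, Step 1; values: Kummer layers; residues: residue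
layers.) [cite: Temkin2013, Thm. 3.2.3 (proof, Step 1)] -/
theorem exists_tame_extension (hC : IsHenselianField C (V.comap (algebraMap C Ω)))
    (hperf : ∀ y ∈ C, ∃ b ∈ C, b ^ p = y) (hr1 : IsRankOneValued V C) :
    ∃ T : Subfield Ω, C ≤ T ∧ (∀ a ∈ T, IsAlgebraic C a) ∧
      IsHenselianField T (V.comap (algebraMap T Ω)) ∧
      (∀ y ∈ T, ∃ b ∈ T, b ^ p = y) ∧
      (∀ b ∈ T, b ≠ 0 → ∀ n : ℕ, n ≠ 0 → ∃ a ∈ T, V.valuation (a ^ n) = V.valuation b) ∧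
      IsAlgClosed (resField V T) ∧ IsRankOneValued V T ∧
      (∀ s : Finset Ω, (↑s : Set Ω) ⊆ T → ∃ P : Polynomial C, P ≠ 0 ∧
        ramificationGroupIn V (IntermediateField.adjoin C (P.rootSet Ω)) = ⊥ ∧
        (↑s : Set Ω) ⊆ IntermediateField.adjoin C (P.rootSet Ω)) ∧
      (∀ P : Polynomial C, P ≠ 0 → ramificationGroupIn V (IntermediateField.adjoin C (P.rootSet Ω)) = ⊥ →
        ((IntermediateField.adjoin C (P.rootSet Ω) : IntermediateField C Ω) : Set Ω) ⊆ T) := by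
  classical
  -- the index set of tame non-zero polynomials and the layers
  let ι := {P : Polynomial C // P ≠ 0 ∧ ramificationGroupIn V (IntermediateField.adjoin C (P.rootSet Ω)) = ⊥}
  let S : ι → Subfield Ω := fun P => (IntermediateField.adjoin C (P.1.rootSet Ω)).toSubfield
  haveI : Nonempty ι := ⟨⟨1, one_ne_zero, ramificationGroupIn_adjoin_rootSet_one_eq_bot V⟩⟩
  have hdir : Directed (· ≤ ·) S := by
    intro P Q
    refine ⟨⟨P.1 * Q.1, mul_ne_zero P.2.1 Q.2.1,
      ramificationGroupIn_adjoin_rootSet_mul_eq_bot V P.2.1 Q.2.1 P.2.2 Q.2.2⟩, ?_, ?_⟩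
    · exact fun w hw => adjoin_rootSet_le_mul_left P.2.1 Q.2.1 hw
    · exact fun w hw => adjoin_rootSet_le_mul_right P.2.1 Q.2.1 hw
  set T : Subfield Ω := ⨆ i, S i with hTdef
  have hmemT : ∀ w : Ω, w ∈ T ↔ ∃ i, w ∈ S i := fun w => Subfield.mem_iSup_of_directed hdir
  have hST : ∀ i, S i ≤ T := fun i => le_iSup S i
  have hCS : ∀ i, C ≤ S i := fun i => le_toSubfield_adjoin_rootSet i.1
  have hCT : C ≤ T := (hCS (Classical.arbitrary ι)).trans (hST _)
  have halgT : ∀ a ∈ T, IsAlgebraic C a := by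
    intro a ha
    obtain ⟨i, hi⟩ := (hmemT a).mp ha
    exact isAlgebraic_of_mem_toSubfield_adjoin_rootSet i.1 hi
  have hT : IsHenselianField T (V.comap (algebraMap T Ω)) := IsHenselianField.of_subfield_algebraic V hCT halgT hC
  have hperfT : ∀ y ∈ T, ∃ b ∈ T, b ^ p = y := by
    intro y hy
    obtain ⟨i, hi⟩ := (hmemT y).mp hy
    obtain ⟨b, hb, hby⟩ := exists_pow_eq_of_mem_toSubfield_adjoin_rootSet i.1 p hperf hi
    exact ⟨b, hST i hb, hby⟩
  have hr1T : IsRankOneValued V T := IsRankOneValued.of_algebraic V hCT hr1 halgT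
  -- finite subsets lie in one layer
  have hfin : ∀ s : Finset Ω, (↑s : Set Ω) ⊆ T → ∃ P : Polynomial C, P ≠ 0 ∧
      ramificationGroupIn V (IntermediateField.adjoin C (P.rootSet Ω)) = ⊥ ∧
      (↑s : Set Ω) ⊆ IntermediateField.adjoin C (P.rootSet Ω) := by
    intro s hs
    obtain ⟨i, hi⟩ := exists_forall_mem_of_directed hdir s fun z hz => hs hz
    exact ⟨i.1, i.2.1, i.2.2, fun z hz => hi z hz⟩
  -- `p^k`-th roots
  have hppow : ∀ k : ℕ, ∀ y ∈ T, ∃ a ∈ T, a ^ p ^ k = y := by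
    intro k
    induction k with
    | zero => intro y hy; exact ⟨y, hy, by rw [pow_zero, pow_one]⟩
    | succ k ih =>
      intro y hy
      obtain ⟨a₁, ha₁, h₁⟩ := ih y hy
      obtain ⟨a, ha, h⟩ := hperfT a₁ ha₁
      exact ⟨a, ha, by rw [pow_succ', pow_mul, h, h₁]⟩
  -- divisibility of values
  have hdiv : ∀ b ∈ T, b ≠ 0 → ∀ n : ℕ, n ≠ 0 → ∃ a ∈ T, V.valuation (a ^ n) = V.valuation b := by
    intro b hb hb0 n hn0
    obtain ⟨k, m, hm, hnkm⟩ := Nat.exists_eq_pow_mul_and_not_dvd hn0 p hp.out.ne_one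
    have hm0 : m ≠ 0 := by rintro rfl; exact hm (dvd_zero p)
    obtain ⟨i, hbi⟩ := (hmemT b).mp hb
    obtain ⟨R, hR0, hR, -, a₁, ha₁, ha₁b⟩ := exists_tame_layer_pow_eq V i.2.1 i.2.2 hbi hb0 hm0
      (valuation_natCast_eq_one_of_not_dvd_residueChar V p hm)
    have ha₁T : a₁ ∈ T := hST ⟨R, hR0, hR⟩ ha₁
    obtain ⟨a, haT, ha⟩ := hppow k a₁ ha₁T
    refine ⟨a, haT, ?_⟩
    rw [hnkm, pow_mul, ha, ha₁b]
  -- algebraically closed residue field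
  have hresT : IsAlgClosed (resField V T) := by
    haveI : IsAlgClosed (ResidueField V) := isAlgClosed_residueField_of_isAlgClosed V
    refine IsAlgClosed.of_exists_root _ fun f hfm hfirr => ?_
    have hf0 : (f.map (algebraMap (resField V T) (ResidueField V))).degree ≠ 0 := by
      rw [Polynomial.degree_map]
      exact fun h0 => hfirr.not_isUnit (Polynomial.isUnit_iff_degree_eq_zero.mpr h0)
    obtain ⟨α, hα⟩ := IsAlgClosed.exists_root _ hf0
    -- `α` is algebraic over `Tv`, hence over `Cv`
    have hαT : IsAlgebraic (resField V T) α :=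
      ⟨f, hfm.ne_zero, by rwa [Polynomial.aeval_def, ← Polynomial.eval_map]⟩
    have hTalg : ∀ r ∈ resField V T, IsAlgebraic (resField V C) r := by
      intro r hr
      obtain ⟨a, haT, rfl⟩ := (mem_resField_iff V T r).mp hr
      exact isAlgebraic_residue_of_isAlgebraic V a.2 (halgT a haT)
    have hαC : IsAlgebraic (resField V C) α :=
      isAlgebraic_trans_subfield (resField_mono V hCT) hTalg hαT
    obtain ⟨R, hR0, hR, hαR⟩ := exists_tame_layer_residue V p hperf hαC
    have hαmem : α ∈ resField V T := resField_mono V (hST ⟨R, hR0, hR⟩) hαR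
    refine ⟨⟨α, hαmem⟩, ?_⟩
    apply (algebraMap (resField V T) (ResidueField V)).injective
    have h1 : (f.map (algebraMap (resField V T) (ResidueField V))).eval α = 0 := hα
    rw [map_zero, ← Polynomial.eval₂_hom, ← Polynomial.eval_map]
    exact h1
  refine ⟨T, hCT, halgT, hT, hperfT, hdiv, hresT, hr1T, hfin, fun P hP0 hP => ?_⟩
  exact fun w hw => hST ⟨P, hP0, hP⟩ hw

end Union

end Literature.AlgebraicGeometry.Resolution

end
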